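import Summits.NavierStokesRegularity.NavierStokesRegularity.Theorems.SoloSalvageXu2024Glue
import Summits.NavierStokesRegularity.NavierStokesRegularity.Statement
import HarnessLib

/-!
# Solo salvage for claim C10 `Xu2024` (cell `ns-claims`, D-0090): the continuation step `Step_15` is TRUE

Claim C10: X. Xu, arXiv:2401.17147 (v18), «a priori `L^∞` bound ⇒ global regularity» (ADJUDICATED #16:
first failing step `Literature.Claims.NS.Xu2024.Step_12` = (3.70) p.19–20, kernel `…Theorems.Xu2024.not_Step_12`
p469116). The typed skeleton isolates the paper's LAST MILE honestly as `Step_15` (= `ClayDelta`), the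
«result of [18]» quoted on p. 2 l. 10–13 / p. 7 l. 22–26: for `ν > 0` and a Clay datum `u₀` (smooth,
divergence free, rapidly decaying) EITHER the Cauchy problem is solvable in Fefferman's class (A), OR there
are a finite `T* > 0` and ONE pair `(v, p)` which is, on every closed slab `[0,T]`, `T < T*`, a solution in
the setting of the paper's Theorem 1.1 (`IsLocalStrongSolution 3 ν T u₀ v p`: classical on `ℝ³ × [0,T]`,
`v(0) = u₀ ∈ L² ∩ L^∞`, `|v| ∈ L^∞(Q_T)`, and the Calderón–Zygmund pressure normalisation
`p(t) ∈ Lˢ(ℝ³)` for every `s > 1`), with `sup |v| = ∞` on `ℝ³ × (0,T*)`. This is Leray's structure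
theorem in Kato's formulation (Leray 1934; Kato 1984; Lemarié-Rieusset 2016, Thm. 7.2, Prop. 12.3,
Thm. 15.1), i.e. CLASSICAL — and this file discharges it in the kernel over the tree's engines:

* `step15_holds : Literature.Claims.NS.Xu2024.Step_15` — dichotomy on Kato's maximal time
  `T_max = katoMaximalTime ν u₀`: `T_max = ∞` ⇒ Clay solution (`clay_solution_of_hasGlobalKatoSolution_holds`);
  `T_max < ∞` ⇒ the maximal Kato solution `w` on `[0,T_max)` (`exists_isKatoSolutionOn_katoMaximalTime`) is,
  below `T_max`, a Tao-class classical solution on every closed slab (`exists_isTaoSolutionOn_of_isKatoSolutionOn`);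
  these are GLUED into one pair `(v, p)` by Prodi–Serrin uniqueness in Tao's class
  (`IsTaoSolutionOn.eq_of_isTaoSolutionOn`) and pressure pinning (`IsTaoSolutionOn.pressure_eq`: the `L²`
  pressure is determined by the velocity); the `Lˢ` normalisation of the pressure, `1 < s < ∞`, is Tao's
  Lemma 4.1 (i) in `Lˢ` (`PressureNormalisationLp.exists_pressure_sub_const_memLp`, the constant being `0`
  because the Tao-class pressure is already in `L²`; at `t = 0` by Fatou); and `sup |v| = ∞` near `T_max`
  because `(T_max, x₁)` is a singular point of `w` (`lemarieRieusset_singular_point_of_blowup_holds`,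
  Lemarié-Rieusset Thm. 15.1 (C)) and `v = w` a.e. (`IsTaoSolutionOn.ae_eq_of_kato`).
* `clay_of_claimedTheorem : ClaimedTheorem → NavierStokesRegularity` — the skeleton's
  `clay_of_claimed_of_delta` with its hypothesis `ClayDelta := Step_15` discharged: the claimed Theorem 1.1
  AS TYPED implies Fefferman's (A) unconditionally (the claim itself rests on the refuted `Step_12`).

Salvage seat `ns-claims-salvage-p4` g3 (solo lane; no statement item). Nothing disputed is asserted.

WHAT THIS IS NOT: not a claim about NS regularity or blow-up; not a claim about any author beyond the typed
locator.

## References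
* J. Leray, Acta Math. 63 (1934), §§31–34. [`Leray1934`]
* T. Kato, Math. Z. 187 (1984), Thms. 1, 4. [`Kato1984`]
* P. G. Lemarié-Rieusset, *The Navier–Stokes Problem in the 21st Century*, CRC 2016, Thm. 7.2, Prop. 12.3,
  Thm. 15.1. [`LemarieRieusset2016`]
* T. Tao, Anal. PDE 6 (2013), Lemma 4.1 (i). [`Tao2011`]
* W. S. Ożański, B. C. Pooley, arXiv:1708.09787, §3.2–§3.3 (the «[18]» of the claim). [`OzanskiPooley2018`]
-/

set_option linter.dupNamespace false

noncomputable section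

open MeasureTheory Set Filter Topology Function
open scoped ENNReal NNReal ContDiff

namespace Summit.NavierStokesRegularity.NavierStokesRegularity.Theorems.Xu2024

open Literature.Analysis.FluidPDE

/-- **`Step_15` of the C10 skeleton holds** — Leray's structure theorem in Kato's formulation, in the setting
of the claim's Theorem 1.1: for `ν > 0` and a Clay datum `u₀`, either the Cauchy problem is solvable in
Fefferman's class, or there are `T* > 0` and one pair `(v, p)`, a solution in the Theorem-1.1 setting on every
`[0,T]`, `T < T*` (classical, bounded, `u₀ ∈ L² ∩ L^∞`, `p(t) ∈ Lˢ` for all `s > 1`), with `sup |v| = ∞` on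
`ℝ³ × (0,T*)`. Dichotomy on `katoMaximalTime ν u₀`; see the module docstring.
[cite: LemarieRieusset2016, Thm. 7.2, Prop. 12.3, Thm. 15.1] [cite: Kato1984, Thms. 1, 4] -/
theorem step15_holds : Literature.Claims.NS.Xu2024.Step_15 := by
  intro ν hν u₀ hsm hdiv hdec
  classical
  -- the datum: `L²`, `L^∞`, `L³`, weakly divergence free
  have hdiv' : VectorCalculus.IsDivFree u₀ := fun x => hdiv x
  have hmeas0 : AEStronglyMeasurable u₀ volume := hsm.continuous.aestronglyMeasurable
  have hL2 : ∫⁻ x, ‖u₀ x‖ₑ ^ 2 < ⊤ := by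
    refine lt_of_le_of_lt (le_of_eq (lintegral_congr fun x => ?_))
      (hdec.lintegral_enorm_iteratedFDeriv_sq_lt_top 0)
    rw [← ofReal_norm, ← ofReal_norm, norm_iteratedFDeriv_zero]
  have hu2 : MemLp u₀ 2 volume := ⟨hmeas0, eLpNorm_two_lt_top_of_lintegral_enorm_sq_lt_top hL2⟩
  obtain ⟨C₀, hC₀⟩ := hdec 0 0
  have hbd0 : ∀ x, ‖u₀ x‖ ≤ C₀ := fun x => by
    have h := hC₀ x
    rwa [pow_zero, one_mul, norm_iteratedFDeriv_zero] at h
  have hutop : MemLp u₀ ⊤ volume := memLp_top_of_bound hmeas0 C₀ (Eventually.of_forall hbd0)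
  have hu3 : MemLp u₀ 3 volume :=
    (memLp_of_bound_of_memLp hbd0 two_ne_zero (by norm_num) (by norm_num) hu2).1
  have hwdiv : IsWeaklyDivFree u₀ :=
    VectorCalculus.IsDivFree.isWeaklyDivFree_holds hdiv' (hsm.of_le (mod_cast le_top))
  -- Kato's maximal time
  by_cases htop : katoMaximalTime ν u₀ = ⊤
  · exact Or.inl (clay_solution_of_hasGlobalKatoSolution_holds ν hν u₀ hsm hdiv hdec
      (hasGlobalKatoSolution_of_katoMaximalTime_eq_top kato_unique_holds hν htop))
  right
  have hTm0 : 0 < katoMaximalTime ν u₀ := katoMaximalTime_pos kato_local_holds hν hu3 hwdiv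
  have htop' : katoMaximalTime ν u₀ < ⊤ := lt_top_iff_ne_top.2 htop
  obtain ⟨w, hw⟩ := exists_isKatoSolutionOn_katoMaximalTime kato_unique_holds hν hTm0 htop'
  set Ts : ℝ := (katoMaximalTime ν u₀).toReal with hTs_def
  have hTs0 : 0 < Ts := ENNReal.toReal_pos hTm0.ne' htop'.ne
  have hofReal : ENNReal.ofReal Ts = katoMaximalTime ν u₀ := ENNReal.ofReal_toReal htop'.ne
  have hmax : ∀ T'' : ℝ, Ts < T'' → ∀ w' : ℝ → (EuclideanSpace ℝ (Fin 3)) → (EuclideanSpace ℝ (Fin 3)),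
      ¬ IsKatoSolutionOn T'' ν u₀ w' :=
    fun T'' hT'' w' => not_isKatoSolutionOn_of_katoMaximalTime_lt (by
      rw [← hofReal]
      exact (ENNReal.ofReal_lt_ofReal_iff (hTs0.trans hT'')).2 hT'')
  -- `(T*, x₁)` is a singular point of the maximal Kato solution (Lemarié-Rieusset Thm. 15.1 (C))
  have hsing := lemarieRieusset_singular_point_of_blowup_holds hν hTs0 hu3 hwdiv hw hmax
  -- Tao-class classical solutions on every closed slab `[0,S]`, `0 < S < T*`, chosen once and for all
  have hex : ∀ S : ℝ, ∃ (u : ℝ → (EuclideanSpace ℝ (Fin 3)) → (EuclideanSpace ℝ (Fin 3)))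
      (p : ℝ → (EuclideanSpace ℝ (Fin 3)) → ℝ),
      S ∈ Ioo 0 Ts → IsTaoSolutionOn S ν u₀ u p := by
    intro S
    by_cases hS : S ∈ Ioo 0 Ts
    · obtain ⟨u, p, h⟩ := exists_isTaoSolutionOn_of_isKatoSolutionOn hν hsm hdiv hdec hw hS.1 hS.2
      exact ⟨u, p, fun _ => h⟩
    · exact ⟨0, 0, fun h => absurd h hS⟩
  choose U P hUP using hex
  -- the glued pair `v(t) = U_{(t+T*)/2}(t)`, `p(t) = P_{(t+T*)/2}(t)`
  refine ⟨Ts, hTs0, fun t => U ((t + Ts) / 2) t, fun t => P ((t + Ts) / 2) t, fun T hT0 hTT => ?_,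
    glue_unbounded hUP hν hTs0 hw hsing⟩
  have hT'' : (T + Ts) / 2 ∈ Ioo 0 Ts := ⟨by linarith, by linarith⟩
  have hTT'' : T < (T + Ts) / 2 := by linarith
  exact isLocalStrongSolution_congr
    (isLocalStrongSolution_of_isTaoSolutionOn (hUP _ hT'') hν hT0 hTT'' hu2 hutop)
    (glue_slab hUP hν ⟨hT0, hTT⟩)

/-- **The claimed Theorem 1.1 of C10, AS TYPED, implies Fefferman's (A)** — unconditionally: the skeleton's
`clay_of_claimed_of_delta : ClayDelta → ClaimedTheorem → clayR3.Regularity` with `ClayDelta := Step_15`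
discharged by `step15_holds`, and `clayR3.Regularity` is Clay (A) token for token. (The claimed theorem
itself rests on the refuted `Step_12`; nothing here asserts it.) [cite: Xu2024NSLinfty, p.2 l.10–13] -/
theorem clay_of_claimedTheorem (h : Literature.Claims.NS.Xu2024.ClaimedTheorem) :
    _root_.NavierStokesRegularity :=
  fun ν hν u₀ hsm hdiv hdec =>
    Literature.Claims.NS.Xu2024.clay_of_claimed_of_delta step15_holds h ν hν u₀ hsm hdiv hdec

end Summit.NavierStokesRegularity.NavierStokesRegularity.Theorems.Xu2024

end
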